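import Summits.AtomisticToContinuum.Crystallization.Theorems.ChartedZeroExcessLayeredLatticeLiouvilleZZZYRB

/-!
# Charted zero-excess layered-lattice Liouville — ZZZYRC: «FullRangeClusterCertificate», the glued split of the signed shell budget (SP♯)

Cell `decomp-a2c`, lens 2 «structural dichotomy (special | generic)», generation 97, third file (D‴).  It SUPERSEDES, as the special side of
record, the tree sibling D′/ZZZYRB ((200) p858465), whose scalar tension floor is refuted in format by the desk — see below; ZZZYRB is imported for
its partition of unity.  NODE D «RigiditySplit» (tree ZZZYRA, (191) p858360) proved
`(RI♯) ∧ (K♯) ∧ (SD♯) ∧ (SP♯) ∧ (CZ♯) ⇒ (U♯) UniformEquilStabilityAt`.  Its special-side crux (SP♯) `SignedShellBudgetP` quantifies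
`∀ a, ∃ (scalar multipliers), ∀ words`; as typed it (i) lets the budget degenerate (`γS = γ = 0`, `γN = κ₁`) into «`κ₁·N₁ − γT·Z ≤ E/2` on every
admissible word» — uniform stability in contact-displacement currency, the whole difficulty — and (ii) prices words by SCALAR per-scale coefficients,
which double worst-cases mixed geometries.  This file splits (SP♯) along the lens once more, over finite CLUSTERS, and makes the degeneration (i) a
theorem:

* **(NL♯) `NullLagrangianP`** [support · ATTACKABLE-S · potential-free, word-free]: the DISCRETE NULL LAGRANGIAN `nullTotal d Cpar Cperp φ`
  — the sum over all plaquettes `(x, a, b)` of `⟪Δ_a φ(x), C (Δ_b φ)(S_a x)⟫ − ⟪Δ_b φ(x), C (Δ_a φ)(S_b x)⟫` for the three commuting index steps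
  (two in-plane translations, one layer step with a per-layer in-plane shift `d`) and coefficient tables invariant under the steps of their
  family — VANISHES for every finitely supported `φ` (re-indexing; the lattice form of `∫ ∂_j u_i ∂_l u_k − ∂_l u_i ∂_j u_k = 0`).
* **(TL♯) `TailBoundP`** [support · ATTACKABLE-S · termwise]: the ordered-pair harmonic form `E` dominates its IN-RANGE part kept EXACTLY
  (`rangeHessSum ϱ`: the tree kernel `layeredKernel` itself on every pair of length `≤ ϱ` — no coefficient table anywhere), minus a
  displacement-currency tail `2τ·N₁` for the pairs in `(ϱ, ϱ₀]` (`V''·s² ≥ −7d⁻⁸·s²`, `(V'/d)·t² ≥ 0` dropped, contact-path count, UY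
  `norm_layeredKernel_le`) and the PROVED (T) extreme tail `2γT·nnFormZ` (UW `tailDominationCert_holds`).
* **(PF♯) `PartitionIdentityFullP`** [support · ATTACKABLE-S · finsum algebra]: the smooth CLUSTER PARTITION OF UNITY on pairs (centre weights
  `siteWeight R` = padded quartic bump `clusterBump` of the distance to the centre, cut at `R`; pair weight = product; normalised by the pair's own
  mass `pairMass`; plaquette weight = product of the four vertex weights, normalised by `plaqMass`) resums the cluster forms:
  `Σ_c clusterFormFull μ ν d Cpar Cperp c φ = rangeHessSum ϱ − μ·S₁ + ν·N₁ + nullTotal d Cpar Cperp φ` (Fubini on finite supports; every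
  pair of length `≤ ϱ` and every plaquette has positive mass once `R ≥ ϱ/2 + 1`, `R > 2r₁`).
* ★ **(JF♯) `ClusterCertificateFullP`** [crux (rank 3) · SPECIAL · INSTRUMENTED · the ONLY piece with Lennard-Jones numbers in it]: for every
  admissible word there are TWO NUMBERS `μ ≥ 0` (contact-stretch credit) and `ν` (contact-displacement ALLOWANCE, either sign), a short layer
  step `d` and null-Lagrangian COEFFICIENT TABLES `(Cpar, Cperp)` with the closure `2(κ₁ + τ) ≤ μ·cK − ν` and, CENTRE BY CENTRE,
  `0 ≤ clusterFormFull r₁ ϱ R μ ν d Cpar Cperp c φ`: the cluster's share of the EXACT Hessian of every pair of length `≤ ϱ` (radial AND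
  transverse = prestress terms, contact AND far shells), minus `μ` on its contact stretches, plus `ν` on its contact displacement differences,
  plus its share of the null Lagrangian — one symmetric matrix per (cluster TYPE ≤ 9 Hägg letters, geometry box) being positive semidefinite.  LOCAL, hence it
  cannot swallow (U♯).  The allowance `ν·N_c` is what makes a LOCAL certificate possible under DEVIATORIC PRESTRESS: an infinitesimal rotation of a
  cluster has zero stretches but non-zero prestress work `ω·(tr Σ_c − Σ_c)·ω` (`Σ_c` = the cluster's virial), of either sign; globally rotations
  are in the kernel of the Hessian of a force-balanced word (row by row `Σ_j K(e_ij)·Ωe_ij = Ω·F_i = 0`), so the rotational density is a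
  bookkeeping artefact.  Two devices absorb it: the NULL-LAGRANGIAN SHARE (coefficients `C_ab = λ·t^a ⊗ Π t^b`, `Π` the star's prestress tensor: smooth
  density `λ((tr ∇u)(Π:∇u) − Π:(∇u)²) = +λ·Π:(WᵀW)` on rotations) CANCELS the rotational prestress density inside the cluster at no global cost — this
  is what carries the COMPRESSED side, where `Π ≈ p·I` is large (`p ≈ 2–4`) and no Korn exchange at rate `cK = 0.118` could pay it; the residue
  (deviatoric cross terms, lattice corrections) is booked by `ν` at its NET value over ALL shells within `ϱ` (the far shells sit in the attractive
  region `V' > 0`; their transverse tension balances, through the virial, the compression of contact bonds on the tensile side) and (K♯) pays `ν·N₁ ≤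
  (ν/cK)·S₁` ONCE; `ν < 0` is a local displacement-coercivity credit.  Desk STRAIN97 (k) (`joint97s.py` CERT-MODE `JOINT_FARX=1`: floating-point
  Cholesky certificates on a `(μ, ν)` search; `R = √5·1.0442`, `ϱ = 49/20`, profile `b0.15`, `cK = 0.118` of record): over all 201 clean
  STRAIN52-strained fcc states of the three thin geometries the certified `κ := max (μ·cK − ν)` has minimum `+0.127` (the dilated-interlayer shear edge
  `(1, 1.04) ⊕ x(0,−1,+1)`, interlayer bonds at `1.059`; per box `0.189 / 0.127 / 0.133`); unstrained `0.245 / 0.250 / 0.319`; Bloch truth at the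
  minimiser `κ_full = 0.194` (`0.288 / 0.318` unstrained) — all with `λ = 0`; on the COMPRESSED side (`P ≤ 0.94`, contact bonds down to `0.86`, `Π ≈
  2–4`) the share is what certifies: with `λ ∈ {0, ¼, ½, ¾}` chosen per state the four 45°-tilted mixed compressed corners certify at `+0.289 / +0.354 /
  +0.442 / +0.252` (`λ = 0`: `−0.076 / −0.014 / +0.221 / +0.015`), the unstrained compressed corners `(0.92,0.96) / (0.8602,1.04) / (0.9,0.96) /
  (0.88,0.98)` at `+1.22 / +1.55 / +1.53 / +2.71`, and the minimum over the 18-state pilot list (8 compressed-tilted, 4 compressed-unstrained, 6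
  tensile-thin) of the best-over-`λ` certificate is `+0.127` (the tensile corner, `λ = 0`).  UNDECIDED(test): census JOINTSTRAIN53 (this engine verbatim
  over `{fcc, hcp, dhcp, 6H, 9R}` × STRAIN52 × the clean `(P, ρ)` box) and the interval K-file of the 72 × (geometry-box) matrix family at the `ϱ` of
  record.
* GLUE (PROVED here): `(K♯) ∧ (NL♯) ∧ (TL♯) ∧ (PF♯) ∧ (JF♯) ⇒ (SP♯)` for EVERY window list `(n, ρ, C)` with the degenerate multipliers
  `(γS, γN, γ) = (0, κ₁, 0)` (`certificateFull_arith`: `E ≥ H_ϱ − 2τN₁ − 2γT·Z`, `H_ϱ + 0 ≥ μS₁ − νN₁`, `… ≥ (μcK − ν − 2τ)N₁ − 2γT·Z`),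
  `(SD♯)` at `n = 0` is vacuous, hence `(RI♯) ∧ (K♯) ∧ (NL♯) ∧ (TL♯) ∧ (PF♯) ∧ (JF♯) ∧ (CZ♯) ⇒ (U♯)` through the tree door
  `uniformEquilStabilityAt_of_rigiditySplit`.

NEGATIVE KNOWLEDGE (two cheaper formats, dead in format at admissible clean strained fcc states — Bravais, hence force-balanced — where truth
has margin `κ_full ≥ 0.19`).  (1) D′/ZZZYRB (tree (200)): the RADIAL table jointly per cluster + a scalar tension floor `β ≤ min V'(ℓ)/ℓ` for the
contact TRANSVERSE terms: at the prestressed tensile corner (`(1.0442, 0.96)` ⊕ STRAIN52 frames, in-plane `≈ 1.044`, interlayer `≈ 0.982`) the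
floor is `β = −0.13` while the clusters certify only `μ ≈ 0.68`, so `μ·cK + β < 0` at 11 of 46 clean states — the debit was exchanged through
Korn at the rate of ALL of `N₁` and the tensile bonds' credit thrown away.  (2) D″ (this certificate with the far pairs reduced to their RADIAL
DEFICITS `min(V'', 0)·s²`, never landed): at the mixed compressed corner (`(1.02, 0.96)` ⊕ `x(+1,−1,0)`, interlayer `0.973`, in-plane `1.040`)
certified `κ = −0.0097` — the far shells' transverse TENSION `(V'/d)·t² > 0`, i.e. the other half of the virial balance, had been discarded, so
the whole rotational debit of the compressed contact bonds (`ν ≈ 0.13`) fell on Korn.  Keeping every in-range pair EXACT removes both artefacts.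
(3) The same exact form WITHOUT the null-Lagrangian share (`λ = 0`) on the compressed mixed corner (`(0.92, 0.96)` ⊕ `x(+1,−1,0)`, contact bonds `0.877
… 0.938`): `ν = 2.38` against `μ = 19.5`, certified `κ = −0.076` — under near-hydrostatic compression the rotational prestress density `≈ p|ω|²` is a
pure partition artefact that the scalar Korn rate cannot carry; the share cancels it (desk (l): `λ = ½` gives `μ = 7.5`, `ν = 0.60`, `κ = +0.289` on the
same 99-site cluster with 280 plaquettes).

Lens statement.  Objects = interacting pairs, as in NODE D; GENERIC = potential-free or termwise ((K♯) Korn of the contact truss, (PF♯) partition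
algebra, (TL♯) tail bookkeeping); SPECIAL = (JF♯), a finite family of explicit matrices indexed by the finitely many cluster types of Barlow words
× geometry boxes (exhaustion: clean ⇒ two-shell pattern ⇒ every `R`-cluster of an admissible word is a strained copy of one of the 72 nine-letter
Hägg environments' clusters; the strain box is the clean window).  Conventions: all pair sums are over ORDERED index pairs (each bond twice), `E`
is the ordered-pair `HasSum` value of B `CoerciveZ` (so (TL♯) compares with `E`, the closure carries the factor `2`, and the door's `κ₁` is
`κ/2 − τ` in the desk's per-bond units `V''(1) = 6`).

POST-MORTEM HOOKS.  (JF♯) false at some admissible geometry box for every `(R, ϱ)` ⇒ no cluster-local certificate in (stretch, displacement)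
currencies exists there and the residual is a genuinely global (Bloch-type, word-uniform) certificate on that box, or a vector-valued Korn
exchange.  (TL♯)/(PF♯) fail only by mis-set `τ` / too small `R` (termwise bounds and identities).
-/

open scoped BigOperators InnerProductSpace RealInnerProductSpace
open MeasureTheory Set Metric Filter Topology

namespace Summit.AtomisticToContinuum.Crystallization.Theorems.ChartedZeroExcessLayeredLatticeLiouville

open Summit.AtomisticToContinuum.Crystallization.Theorems.ChartedPlanarOrderRigidityDoor (E3 IsClean IsNash)
open Summit.AtomisticToContinuum.Crystallization.Theorems.ChartedPlanarOrderDensityDichotomy (μS)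
open Summit.AtomisticToContinuum.Crystallization.Theorems.ChartedPlanarOrderMesoCut (LayeredHom)
open Summit.AtomisticToContinuum.Crystallization.Theorems.ChartedPlanarOrderDoorLayered (Layered)
open Summit.AtomisticToContinuum.Crystallization.Theorems.ChartedPlanarOrderNashForceBalance (ljDeriv)
open Literature.MathematicalPhysics.StatisticalMechanics (triangularVec₁ triangularVec₂)

noncomputable section

/-! ### The cluster partition of unity and the exact in-range form -/

/-! Re-used VERBATIM from the tree sibling ZZZYRB ((200) p858465): the cluster partition of unity `clusterBump`, `siteWeight`, `pairWeight`,
`pairMass`, the squared stretch `sqStretch`, and `shellStretchDominationP_zero`; ZZZYRB's (HS♯)/(PU♯)/(TB♯)/(JC♯) and its glue stay in the tree as the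
(refuted-in-format, see above) scalar-floor variant — nothing below depends on them. -/

/-- THE EXACT HESSIAN SUMMAND of the ordered pair `x` under `φ`: `⟨Δφ, layeredKernel (γ' − γ) m m' Δφ⟩` — verbatim the summand of the
`HasSum` in B `CoerciveZ` / (SP♯). [g97] -/
def pairHess (a b : E3) (w : ℤ → E3) (φ : Cell 2 → ℤ → E3) (x : (Cell 2 × ℤ) × (Cell 2 × ℤ)) : ℝ :=
  ⟪φ x.2.1 x.2.2 - φ x.1.1 x.1.2, layeredKernel a b w (x.2.1 - x.1.1) x.1.2 x.2.2 (φ x.2.1 x.2.2 - φ x.1.1 x.1.2)⟫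

/-- THE IN-RANGE PART OF THE HARMONIC FORM, kept EXACTLY: `Σ_{0 < ‖e‖ ≤ ϱ} ⟨Δφ, K Δφ⟩` over ordered pairs — contact AND far pairs alike,
radial AND transverse parts alike (the far shells of a clean word sit in the attractive region `V' > 0`: their transverse terms `(V'/ℓ)·t²`
are the tension CREDIT that balances, through the virial, the rotational debit of compressed contact bonds — desk STRAIN97 (k)). [g97] -/
def rangeHessSum (ϱ : ℝ) (a b : E3) (w : ℤ → E3) (φ : Cell 2 → ℤ → E3) : ℝ :=
  ∑ᶠ x : (Cell 2 × ℤ) × (Cell 2 × ℤ), if 0 < ‖bondVec a b w x‖ ∧ ‖bondVec a b w x‖ ≤ ϱ then pairHess a b w φ x else 0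

/-! ### The discrete null Lagrangian (plaquette forms) and its cluster shares -/

/-- THE THREE COMMUTING INDEX STEPS: `a = 0, 1` the in-plane index translations `γ ↦ γ + e_a`, `a = 2` the LAYER STEP
`(γ, m) ↦ (γ + d m, m + 1)` with a per-layer in-plane index shift `d` (chosen per word so that the step is an interlayer contact bond). [g97] -/
def stepIdx (d : ℤ → Cell 2) (a : Fin 3) (x : Cell 2 × ℤ) : Cell 2 × ℤ :=
  if a = 0 then (x.1 + Pi.single 0 1, x.2) else if a = 1 then (x.1 + Pi.single 1 1, x.2) else (x.1 + d x.2, x.2 + 1)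

/-- the layer step of `d` is a short bond of the word (`≤ r₁`): plaquettes then fit into cluster balls. [g97] -/
def IsShortStep (r₁ : ℝ) (a b : E3) (w : ℤ → E3) (d : ℤ → Cell 2) : Prop :=
  ∀ x : Cell 2 × ℤ, ‖lsite a b w (stepIdx d 2 x).1 (stepIdx d 2 x).2 - lsite a b w x.1 x.2‖ ≤ r₁

/-- PLAQUETTE COEFFICIENTS: a `3 × 3` real operator per plaquette family `(a, b)`; for the in-plane families (`a, b ∈ {0, 1}`) it may depend
on the LAYER (`Cpar m a b`), for the families through the layer step (`2 ∈ {a, b}`) it is CONSTANT (`Cperp a b`) — exactly the invariance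
under the two steps of the family that makes the plaquette form telescope to zero. [g97] -/
def plaqCoef (Cpar : ℤ → Fin 3 → Fin 3 → (E3 →L[ℝ] E3)) (Cperp : Fin 3 → Fin 3 → (E3 →L[ℝ] E3)) (x : Cell 2 × ℤ) (a b : Fin 3) :
    E3 →L[ℝ] E3 :=
  if a = 2 ∨ b = 2 then Cperp a b else Cpar x.2 a b

/-- THE PLAQUETTE TERM at `p = (x, a, b)`: `⟪Δ_a φ(x), C (Δ_b φ)(S_a x)⟫ − ⟪Δ_b φ(x), C (Δ_a φ)(S_b x)⟫` (`Δ_a φ(y) = φ(S_a y) − φ(y)`).  Smooth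
meaning: with `C_ab = t^a ⊗ Π t^b` (`t` the dual frame of the step vectors, `Π = −Σ_e (V'/ℓ) e ⊗ e` the star's prestress tensor) the
density is `(tr ∇u)(Π : ∇u) − Π : (∇u)²`, which on an infinitesimal rotation `W` equals `+Π : (WᵀW)` — it CANCELS the rotational prestress
density `−Π : (WᵀW)` of the pair terms (desk STRAIN97 (l)). [g97] -/
def nullTerm (d : ℤ → Cell 2) (Cpar : ℤ → Fin 3 → Fin 3 → (E3 →L[ℝ] E3)) (Cperp : Fin 3 → Fin 3 → (E3 →L[ℝ] E3))
    (φ : Cell 2 → ℤ → E3) (p : (Cell 2 × ℤ) × Fin 3 × Fin 3) : ℝ :=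
  ⟪φ (stepIdx d p.2.1 p.1).1 (stepIdx d p.2.1 p.1).2 - φ p.1.1 p.1.2,
      plaqCoef Cpar Cperp p.1 p.2.1 p.2.2
        (φ (stepIdx d p.2.2 (stepIdx d p.2.1 p.1)).1 (stepIdx d p.2.2 (stepIdx d p.2.1 p.1)).2
          - φ (stepIdx d p.2.1 p.1).1 (stepIdx d p.2.1 p.1).2)⟫
    - ⟪φ (stepIdx d p.2.2 p.1).1 (stepIdx d p.2.2 p.1).2 - φ p.1.1 p.1.2,
        plaqCoef Cpar Cperp p.1 p.2.1 p.2.2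
          (φ (stepIdx d p.2.1 (stepIdx d p.2.2 p.1)).1 (stepIdx d p.2.1 (stepIdx d p.2.2 p.1)).2
            - φ (stepIdx d p.2.2 p.1).1 (stepIdx d p.2.2 p.1).2)⟫

/-- THE DISCRETE NULL LAGRANGIAN: the sum of all plaquette terms (finite for finitely supported `φ`).  (NL♯) says it VANISHES. [g97] -/
def nullTotal (d : ℤ → Cell 2) (Cpar : ℤ → Fin 3 → Fin 3 → (E3 →L[ℝ] E3)) (Cperp : Fin 3 → Fin 3 → (E3 →L[ℝ] E3))
    (φ : Cell 2 → ℤ → E3) : ℝ :=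
  ∑ᶠ p : (Cell 2 × ℤ) × Fin 3 × Fin 3, nullTerm d Cpar Cperp φ p

/-- WEIGHT OF THE PLAQUETTE `p = (x, a, b)` IN THE CLUSTER CENTRED AT `c`: the product of its four vertices' weights. [g97] -/
def plaqWeight (R : ℝ) (a b : E3) (w : ℤ → E3) (d : ℤ → Cell 2) (c : Cell 2 × ℤ) (p : (Cell 2 × ℤ) × Fin 3 × Fin 3) : ℝ :=
  siteWeight R a b w c p.1 * siteWeight R a b w c (stepIdx d p.2.1 p.1) * siteWeight R a b w c (stepIdx d p.2.2 p.1)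
    * siteWeight R a b w c (stepIdx d p.2.2 (stepIdx d p.2.1 p.1))

/-- MASS OF THE PLAQUETTE `p`: its total weight over all centres (positive once its diameter `≤ 2r₁` is below `R`). [g97] -/
def plaqMass (R : ℝ) (a b : E3) (w : ℤ → E3) (d : ℤ → Cell 2) (p : (Cell 2 × ℤ) × Fin 3 × Fin 3) : ℝ :=
  ∑ᶠ c : Cell 2 × ℤ, plaqWeight R a b w d c p

/-- ★ THE FULL-RANGE CLUSTER FORM at centre `c` with contact-stretch credit `μ`, contact-displacement allowance `ν` (of either sign) and
null-Lagrangian coefficient tables `(d, Cpar, Cperp)`: the cluster's share (pair weight / pair mass) of the EXACT Hessian of every pair of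
length `≤ ϱ`, minus `μ·s²` plus `ν·‖Δφ‖²` on its contact pairs (`‖e‖ ≤ r₁`), plus its share (plaquette weight / plaquette mass) of the
discrete null Lagrangian — a quadratic form in the finitely many values of `φ` on the sites within `R` of `c`. [g97] -/
def clusterFormFull (r₁ ϱ R μ ν : ℝ) (d : ℤ → Cell 2) (Cpar : ℤ → Fin 3 → Fin 3 → (E3 →L[ℝ] E3)) (Cperp : Fin 3 → Fin 3 → (E3 →L[ℝ] E3))
    (a b : E3) (w : ℤ → E3) (c : Cell 2 × ℤ) (φ : Cell 2 → ℤ → E3) : ℝ :=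
  (∑ᶠ x : (Cell 2 × ℤ) × (Cell 2 × ℤ),
    pairWeight R a b w c x / pairMass R a b w x *
      ((if 0 < ‖bondVec a b w x‖ ∧ ‖bondVec a b w x‖ ≤ ϱ then pairHess a b w φ x else 0)
        + (if 0 < ‖bondVec a b w x‖ ∧ ‖bondVec a b w x‖ ≤ r₁ then
            ν * ‖φ x.2.1 x.2.2 - φ x.1.1 x.1.2‖ ^ 2 - μ * sqStretch a b w φ x else 0)))
  + ∑ᶠ p : (Cell 2 × ℤ) × Fin 3 × Fin 3, plaqWeight R a b w d c p / plaqMass R a b w d p * nullTerm d Cpar Cperp φ p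

/-! ### The three pieces of the split of (SP♯) -/

/-- **(NL♯) «NullLagrangianP»** — THE PLAQUETTE FORMS TELESCOPE (support · ATTACKABLE-S · potential-free, word-free): for every per-layer
shift `d`, all coefficient tables and every finitely supported `φ`, `nullTotal d Cpar Cperp φ = 0`.  Proof sketch: for each ordered family
`(a, b)` the two steps `S_a, S_b` are COMMUTING BIJECTIONS of `Cell 2 × ℤ` and the coefficient is invariant under both, so after expanding
the four products and re-indexing the finite sums (`y = S_a x`, …) the family's total is `Σ_x ⟪φ x, C φ(S_a S_b x)⟫ − Σ_x ⟪φ x, C φ(S_b S_a x)⟫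
= 0`; `a = b` terms vanish identically.  The lattice version of `∫ (∂_j u_i ∂_l u_k − ∂_l u_i ∂_j u_k) = 0`.  WEAKER than (U♯): a
combinatorial identity with no potential, no geometry and no sign.  Why it might fail: only by a typo in the invariance bookkeeping (a
layer-dependent coefficient on a family through the layer step would break it — `plaqCoef` forbids that).  Sources: Ball–Currie–Olver null
Lagrangians (1981); desk identity check STRAIN97 (l). [g97] -/
def NullLagrangianP : Prop :=
  ∀ (d : ℤ → Cell 2) (Cpar : ℤ → Fin 3 → Fin 3 → (E3 →L[ℝ] E3)) (Cperp : Fin 3 → Fin 3 → (E3 →L[ℝ] E3)) (φ : Cell 2 → ℤ → E3),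
    HasFiniteSupport φ → nullTotal d Cpar Cperp φ = 0

/-- **(TL♯) «TailBoundP s Λ c₀ ℓ₀ r₁ ϱ τ γT»** — THE TAIL BEYOND THE RANGE (support · ATTACKABLE-S · termwise): on every admissible word, for
every finitely supported `φ` and every value `E` of the ordered-pair harmonic form, `rangeHessSum ϱ − 2τ·N₁ − 2γT·nnFormZ ≤ E`.  Pairs of length
`≤ ϱ` are kept exactly; a pair beyond `ϱ` has `⟨v, forceConst e v⟩ = V''·s² + (V'/d)·t² ≥ V''·s²` (`V'(d)/d > 0` for `d > 1`) with `|V''(d)| ≤ 7d⁻⁸`,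
booked in contact-displacement currency along contact paths for `d ≤ ϱ₀` (`τ`, a finite lattice sum `≈ Σ_{d > ϱ} n(d)·7d⁻⁸·d²`) and by the PROVED
(T) beyond (`γT`).  WEAKER than (U♯): a termwise inequality with no sign conclusion.  Why it might fail: only by a mis-set `τ` for the chosen `ϱ`
(the thinnest pilot box has `κ ≈ 0.127` at `ϱ = 49/20`; the K-file of record takes `ϱ ≥ 7/2`, where the desk tail estimate is `τ ≈ 0.02` and
the in-range extension costs `≈ 0.017` of `κ`; `τ(ϱ) = O(ϱ⁻³)`).  Sources: ZZZYJ `bondHess`, B `forceConst_apply`, NashForceBalance `ljDeriv_pos_of_one_lt`, UY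
`norm_layeredKernel_le`, UW. [g97] -/
def TailBoundP (s Λ c₀ ℓ₀ r₁ ϱ τ γT : ℝ) : Prop :=
  ∀ a : ℝ, 0 < a → ∀ (L : E3 ≃L[ℝ] E3) (w' : ℤ → E3), IsAdmissibleWord a s Λ c₀ ℓ₀ L w' →
    ∀ φ : Cell 2 → ℤ → E3, HasFiniteSupport φ → ∀ E : ℝ,
      HasSum (fun x : (Cell 2 × ℤ) × (Cell 2 × ℤ) =>
        ⟪φ x.2.1 x.2.2 - φ x.1.1 x.1.2,
          layeredKernel (gen₁ L) (gen₂ L) w' (x.2.1 - x.1.1) x.1.2 x.2.2 (φ x.2.1 x.2.2 - φ x.1.1 x.1.2)⟫) E →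
      rangeHessSum ϱ (gen₁ L) (gen₂ L) w' φ - 2 * τ * contactForm r₁ (gen₁ L) (gen₂ L) w' φ - 2 * γT * nnFormZ φ ≤ E

/-- **(PF♯) «PartitionIdentityFullP s Λ c₀ ℓ₀ r₁ ϱ R»** — THE CLUSTER PARTITION OF UNITY RESUMS THE FULL-RANGE FORM (support · ATTACKABLE-S):
on every admissible word, for every finitely supported `φ`, all `μ ν` and all null-Lagrangian tables `(d, Cpar, Cperp)` whose layer step
is a short bond, the cluster forms are summable over the centres with sum `rangeHessSum ϱ − μ·S₁ + ν·N₁ + nullTotal`.  Content: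
`Σ_c pairWeight c x = pairMass x > 0` for every pair of length `≤ ϱ` (needs `R ≥ ϱ/2 + 1`) and `Σ_c plaqWeight c p = plaqMass p > 0` for
every plaquette (diameter `≤ 2r₁ < R`), finsum Fubini over (centre, pair / plaquette) on finite supports.  WEAKER: pure bookkeeping.  Why it
might fail: `R` too small (a massless in-range pair or plaquette would be silently dropped — the desk audits coverage).  Sources: JOINT-97
coverage audit. [g97] -/
def PartitionIdentityFullP (s Λ c₀ ℓ₀ r₁ ϱ R : ℝ) : Prop :=
  ∀ a : ℝ, 0 < a → ∀ (L : E3 ≃L[ℝ] E3) (w' : ℤ → E3), IsAdmissibleWord a s Λ c₀ ℓ₀ L w' →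
    ∀ φ : Cell 2 → ℤ → E3, HasFiniteSupport φ → ∀ (μ ν : ℝ) (d : ℤ → Cell 2)
      (Cpar : ℤ → Fin 3 → Fin 3 → (E3 →L[ℝ] E3)) (Cperp : Fin 3 → Fin 3 → (E3 →L[ℝ] E3)), IsShortStep r₁ (gen₁ L) (gen₂ L) w' d →
      HasSum (fun c : Cell 2 × ℤ => clusterFormFull r₁ ϱ R μ ν d Cpar Cperp (gen₁ L) (gen₂ L) w' c φ)
        (rangeHessSum ϱ (gen₁ L) (gen₂ L) w' φ
          - μ * stretchForm 0 r₁ (gen₁ L) (gen₂ L) w' φ + ν * contactForm r₁ (gen₁ L) (gen₂ L) w' φ + nullTotal d Cpar Cperp φ)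

/-- ★ **(JF♯) «ClusterCertificateFullP s Λ c₀ ℓ₀ r₁ ϱ R cK τ κ₁»** — THE FULL-RANGE PRESTRESSED CLUSTER CERTIFICATE (crux, rank 3 · SPECIAL ·
INSTRUMENTED): for every admissible word there are `μ ν : ℝ`, `0 ≤ μ` (`ν` of either sign), with the CLOSURE `2(κ₁ + τ) ≤ μ·cK − ν` and AT EVERY
CENTRE the finite-dimensional inequality `0 ≤ clusterFormFull r₁ ϱ R μ ν c φ` (all `φ`; only the values on the `R`-ball about `c` enter).  Every
pair of length `≤ ϱ` enters with its OWN exact Hessian block (radial `V''·s²` and transverse `(V'/ℓ)·t²`, of whatever sign), mode by mode; `μ`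
sells contact stretch, `ν` books the NET rotational prestress density of the cluster (contact compression debit MINUS far-shell tension credit)
and is paid once through (K♯) when positive.  Desk STRAIN97 (k) (`joint97s.py` CERT-MODE, `JOINT_FARX=1`: floating-point Cholesky certificates of
`A_c − μS_c + νN_c + P_transl` on a `(μ, ν)` search, `R = √5·1.0442`, `ϱ = 49/20`, profile `clusterBump`, `cK = 0.118`, actual deformed geometry,
clean proxy per state): over ALL 201 clean STRAIN52-strained fcc states of the three thin geometries `(1.0442, 0.96)`, `(1, 1.04)`,
`(1.02, 0.96)` the certified `κ = μ·cK − ν` has minimum `+0.127` (the dilated-interlayer shear edge `(1, 1.04) ⊕ x(0,−1,+1)`, interlayer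
bonds at `1.059`; per box `0.189 / 0.127 / 0.133`), unstrained `0.245 / 0.250 / 0.319`; Bloch truth at the minimiser
`κ_full = 0.194` (`0.288 / 0.318` unstrained) (in the `ν ≥ 0` sub-search `R = 2√2·1.0442` gives the same value as `R = √5·1.0442`
there: the residual loss is the scalar Korn exchange, not locality).  The two cheaper formats die on the same states: the scalar tension
floor of the tree sibling ZZZYRB (200) at the prestressed tensile corner (11/46 negative), the far-RADIAL-deficit version of this certificate
(D″, superseded before landing) at the mixed compressed corner (`(1.02, 0.96) ⊕ x(+1,−1,0)`: `−0.0097`; it discards the far shells'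
transverse tension).  WEAKER than (U♯): local (one cluster at a time), no
summation, no Korn, no currency.  Why it might fail: non-Bravais words (hcp, dhcp, 6H, 9R letters) under strain are not homogeneously
force-balanced and their admissible strained states carry inner displacements the fcc pilot does not see; the margin `0.127 − 0.017` (tail
`ϱ ↦ 3.47`) must still hold `2(κ₁ + τ)` with `τ(3.47) ≈ 0.02` and the interval slack — if a box goes thin, enlarge `ϱ` and `R` (`τ(ϱ) = O(ϱ⁻³)`)
before any dial on the clean window; census JOINTSTRAIN53 decides.  Sources: STRAIN97 / JOINT-97 / CASTRAIN-97(s) desk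
(memo NODE-g97 §3 (f)–(k)); census STRAIN52 (evidence #41 on 26636). [g97] -/
def ClusterCertificateFullP (s Λ c₀ ℓ₀ r₁ ϱ R cK τ κ₁ : ℝ) : Prop :=
  ∀ a : ℝ, 0 < a → ∀ (L : E3 ≃L[ℝ] E3) (w' : ℤ → E3), IsAdmissibleWord a s Λ c₀ ℓ₀ L w' →
    ∃ (μ ν : ℝ) (d : ℤ → Cell 2) (Cpar : ℤ → Fin 3 → Fin 3 → (E3 →L[ℝ] E3)) (Cperp : Fin 3 → Fin 3 → (E3 →L[ℝ] E3)),
      0 ≤ μ ∧ IsShortStep r₁ (gen₁ L) (gen₂ L) w' d ∧ 2 * (κ₁ + τ) ≤ μ * cK - ν ∧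
      ∀ (c : Cell 2 × ℤ) (φ : Cell 2 → ℤ → E3), HasFiniteSupport φ →
        0 ≤ clusterFormFull r₁ ϱ R μ ν d Cpar Cperp (gen₁ L) (gen₂ L) w' c φ

/-- THE CERTIFICATE ARITHMETIC (pure real inequalities): tail bound + resummed certificate + Korn + closure ⇒ the degenerate budget
`κ₁·N₁ − γT·Z ≤ E/2`. [g97] -/
theorem certificateFull_arith {H S₁ N₁ Z E μ ν τ γT cK κ₁ : ℝ} (hFS : H - 2 * τ * N₁ - 2 * γT * Z ≤ E) (hcert : 0 ≤ H - μ * S₁ + ν * N₁)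
    (hK1 : cK * N₁ ≤ S₁) (hN : 0 ≤ N₁) (hμ : 0 ≤ μ) (hc : 2 * (κ₁ + τ) ≤ μ * cK - ν) : κ₁ * N₁ - γT * Z ≤ E / 2 := by
  have h1 : μ * (cK * N₁) ≤ μ * S₁ := mul_le_mul_of_nonneg_left hK1 hμ
  have h2 : 2 * (κ₁ + τ) * N₁ ≤ (μ * cK - ν) * N₁ := mul_le_mul_of_nonneg_right hc hN
  nlinarith [h1, h2, hFS, hcert]

/-- ★★ **GLUE «FullRangeClusterCertificate» (PROVED): (K♯) ∧ (NL♯) ∧ (TL♯) ∧ (PF♯) ∧ (JF♯) ⇒ (SP♯)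
`SignedShellBudgetP s Λ c₀ ℓ₀ r₁ cK κ₁ γT n ρ C`** for EVERY window
list `(n, ρ, C)` — with the degenerate multipliers `γS = 0`, `γN = κ₁`, `γ = 0`: the per-word pair `(μ, ν)` of (JF♯) is uniformised through Korn
(`certificateFull_arith`), the resummation (PF♯) turns the centre-wise certificate into `μ·S₁ − ν·N₁ ≤ rangeHessSum ϱ + nullTotal`
(`HasSum.nonneg`), (NL♯) deletes `nullTotal`, (TL♯) compares with `E`. [g97] -/
theorem signedShellBudgetP_of_clusterCertificateFull {s Λ c₀ ℓ₀ r₁ ϱ R cK τ κ₁ γT : ℝ} {n : ℕ} {ρ C : ℕ → ℝ}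
    (hK : UniformContactKornP s Λ c₀ ℓ₀ r₁ cK) (hNL : NullLagrangianP) (hFS : TailBoundP s Λ c₀ ℓ₀ r₁ ϱ τ γT)
    (hPU : PartitionIdentityFullP s Λ c₀ ℓ₀ r₁ ϱ R) (hJC : ClusterCertificateFullP s Λ c₀ ℓ₀ r₁ ϱ R cK τ κ₁) :
    SignedShellBudgetP s Λ c₀ ℓ₀ r₁ cK κ₁ γT n ρ C := by
  intro a ha
  refine ⟨0, κ₁, fun _ => 0, fun _ => le_rfl, ?_, ?_, ?_⟩
  · simp
  · simp
  intro L w' hadm φ hφ E hE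
  obtain ⟨μ, ν, d, Cpar, Cperp, hμ, hd, hc, hcl⟩ := hJC a ha L w' hadm
  have h1 := hFS a ha L w' hadm φ hφ E hE
  have h2 := hPU a ha L w' hadm φ hφ μ ν d Cpar Cperp hd
  have h0 : nullTotal d Cpar Cperp φ = 0 := hNL d Cpar Cperp φ hφ
  have hcert' : 0 ≤ rangeHessSum ϱ (gen₁ L) (gen₂ L) w' φ
      - μ * stretchForm 0 r₁ (gen₁ L) (gen₂ L) w' φ + ν * contactForm r₁ (gen₁ L) (gen₂ L) w' φ + nullTotal d Cpar Cperp φ :=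
    HasSum.nonneg (fun c => hcl c φ hφ) h2
  have hcert : 0 ≤ rangeHessSum ϱ (gen₁ L) (gen₂ L) w' φ
      - μ * stretchForm 0 r₁ (gen₁ L) (gen₂ L) w' φ + ν * contactForm r₁ (gen₁ L) (gen₂ L) w' φ := by linarith
  obtain ⟨hK1, _⟩ := hK a ha L w' hadm φ hφ
  have hN : 0 ≤ contactForm r₁ (gen₁ L) (gen₂ L) w' φ := contactForm_nonneg _ _ _ _ _
  have hmain := certificateFull_arith h1 hcert hK1 hN hμ hc
  simpa using hmain

/-- ★★ **THE DOOR OF RECORD AFTER THE SPLIT (PROVED): (RI♯) ∧ (K♯) ∧ (NL♯) ∧ (TL♯) ∧ (PF♯) ∧ (JF♯) ∧ (CZ♯) ⇒ (U♯)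
`UniformEquilStabilityAt s Λ κ₀ c₀`** for every
`κ₀ ≤ κ₁·cZ − γT`, `0 ≤ κ₁` — the tree door `uniformEquilStabilityAt_of_rigiditySplit` at the empty window list. [g97] -/
theorem uniformEquilStabilityAt_of_clusterCertificateFull {s Λ c₀ ℓ₀ r₁ ϱ R cK cZ τ κ₁ κ₀ γT : ℝ} (h0 : 0 ≤ κ₁) (hκ : κ₀ ≤ κ₁ * cZ - γT)
    (hRI : UniformReindexP s Λ c₀ ℓ₀) (hK : UniformContactKornP s Λ c₀ ℓ₀ r₁ cK) (hNL : NullLagrangianP) (hFS : TailBoundP s Λ c₀ ℓ₀ r₁ ϱ τ γT)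
    (hPU : PartitionIdentityFullP s Λ c₀ ℓ₀ r₁ ϱ R) (hJC : ClusterCertificateFullP s Λ c₀ ℓ₀ r₁ ϱ R cK τ κ₁)
    (hCZ : IndexCurrencyP s Λ c₀ ℓ₀ r₁ cZ) : UniformEquilStabilityAt s Λ κ₀ c₀ :=
  uniformEquilStabilityAt_of_rigiditySplit (n := 0) (ρ := fun _ => 0) (C := fun _ => 0) h0 hκ hRI hK (shellStretchDominationP_zero _ _ _ _ _ _ _)
    (signedShellBudgetP_of_clusterCertificateFull hK hNL hFS hPU hJC) hCZ

/-- RECORD INSTANCE at the record chart class `(s, Λ) = (1/50, 2)`, `ℓ₀ = 3`, contact cut-off `r₁ = 9/8`, stretch window `ϱ = 7/2`, cluster radius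
`R = 3` (`≥ ϱ/2 + 1`), Korn constant `cK = 1/10`, middle-tail price `τ = 1/50` (desk `τ(3.47) ≈ 0.017`), certificate constant `κ₁ = 1/40`
(closure `2(κ₁ + τ) = 9/100 ≤ μ·cK − ν − τ`, desk book `0.127 − 0.017 = 0.11` at the tensile shear edge, STRAIN97 / JOINTSTRAIN53 spec), no (T)-tail
(`γT = 0`): (U♯) holds with `κ₀ = cZ/40`. [g97; GO edition 2, g98: record constants moved inside the desk book per critic r1758] -/
example {c₀ cZ : ℝ} (hRI : UniformReindexP (1 / 50) 2 c₀ 3) (hK : UniformContactKornP (1 / 50) 2 c₀ 3 (9 / 8) (1 / 10))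
    (hNL : NullLagrangianP) (hFS : TailBoundP (1 / 50) 2 c₀ 3 (9 / 8) (7 / 2) (1 / 50) 0) (hPU : PartitionIdentityFullP (1 / 50) 2 c₀ 3 (9 / 8) (7 / 2) 3)
    (hJC : ClusterCertificateFullP (1 / 50) 2 c₀ 3 (9 / 8) (7 / 2) 3 (1 / 10) (1 / 50) (1 / 40))
    (hCZ : IndexCurrencyP (1 / 50) 2 c₀ 3 (9 / 8) cZ) : UniformEquilStabilityAt (1 / 50) 2 (cZ / 40) c₀ :=
  uniformEquilStabilityAt_of_clusterCertificateFull (κ₁ := 1 / 40) (γT := 0) (by norm_num) (by ring_nf; rfl) hRI hK hNL hFS hPU hJC hCZ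

end

end Summit.AtomisticToContinuum.Crystallization.Theorems.ChartedZeroExcessLayeredLatticeLiouville
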